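import Literature.RepresentationTheory.FiniteGroups.InducedInvariantsCharpoly
import Literature.NumberTheory.GaloisRepresentations.CoinvariantsQuadraticTwist
import Literature.RepresentationTheory.Semisimple.CharpolySubquotient
import Mathlib.RepresentationTheory.Coinvariants
import HarnessLib

/-!
# Local Artin formalism for an abelian extension on inertia coinvariants, at an arbitrary place

Topic `Literature/NumberTheory/GaloisRepresentations`.  THEOREMS ONLY (no definition, no named
fact).  Sibling of `CoinvariantsQuadraticTwist{,Ramified}` (the quadratic case) and of
`CoinvariantsFiniteIndexUnipotent` (unipotent inertia), which it generalises: the pure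
representation theory behind

  `∏_{w ∣ v} L_w(V|_{Γ_F}, X^{f(w|v)}) = ∏_{χ ∈ Gal(F/K)^} L_v(V ⊗ χ, X)`

for a finite ABELIAN extension `F/K` of number fields, an arbitrary finite place `v` (ramified
or not) and an `ℓ`-adic representation `V` of `Γ_K` on which the inertia group may act in ANY
way (e.g. the Tate module of an elliptic curve with additive, potentially good reduction at a
prime ramified in `F`), the local factors being Serre's
`L(V, X) = det(1 - X Frob ∣ V_{I})` on inertia **co**invariants with an arithmetic Frobenius
(*Facteurs locaux des fonctions zêta*, Sém. DPP 1969/70, §2.3; the tree's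
`ContinuousRep.toInertiaCoinvariants`, `WeierstrassCurve.reverse_charpoly_toInertiaCoinvariants_eq_localPolynomialAt`).
The arithmetic dictionary (decomposition groups of `Γ_ℚ`, Dirichlet characters, the Tate module)
is applied in `EllipticCurves/ArtinFormalismAbelianGaloisLocalProofs`; here everything is about an
abstract group `D` (the decomposition group at a prime `𝔓 ∣ v` of `K̄`) acting on a
finite-dimensional vector space `V` over a field `k` of characteristic `0`, with

* `I ⊴ D` (inertia), `D_F ⊴ D` of finite index (`D ∩ Γ_F`), so that the inertia of `F` at the
  prime below `𝔓` is `I ∩ D_F` and `Q = D/(I ∩ D_F)` contains the FINITE image `J` of `I`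
  (`≅ I(w|v)`) meeting the image of `D_F` trivially;
* a finite family of characters `ψᵢ : D → kˣ` with `∑ᵢ ψᵢ(x) = N · [x ∈ D_F]` (in the
  application: the characters of `Gal(F/K)` restricted to `D`, `N = [F : K]`);
* `φ ∈ D` (a Frobenius at `𝔓`), `f ≥ 1` such that `φ^m ∈ I D_F ⇒ f ∣ m` for `m ≥ 1`, and
  `Φ ∈ D_F ∩ I φ^f` (a Frobenius of `F` at the prime above; so `f = f(w|v)`);
* `g` with `g f [I : I ∩ D_F] = N` (`g` = number of places of `F` above `v`,
  `[I : I ∩ D_F] = e(w|v)`).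

Main statement: `prod_reverse_charpoly_toCoinvariants_twist_eq_pow_expand`,

  `∏ᵢ det(1 - X ψᵢ(φ) φ ∣ (V ⊗ ψᵢ)_I) = det(1 - X^f Φ ∣ V_{I ∩ D_F})^g`.

## Proof (Artin's route through traces, *Hamb. Abh.* 8 (1931), §2)

1. `prod_reverse_charpoly_eq_pow_expand_of_trace_pow` — `∏ᵢ det(1 - X Bᵢ) = det(1 - X^f M)^g` as
   soon as `∑ᵢ tr(Bᵢ^m) = [f ∣ m] g f tr(M^{m/f})` for all `m ≥ 1` (logarithms of Euler
   factors; the tree's `exp_subst_endTraceLogSeries_mul_reverse_charpoly`,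
   `Literature.AlgebraicGeometry.Motives.FrobeniusTraceProofs`, and the finite-group file
   `Literature.RepresentationTheory.FiniteGroups.InducedInvariantsCharpoly`).
2. `charpoly_toCoinvariants_eq_charpoly_restrict_invariants`, `card_mul_trace_toCoinvariants` —
   for a FINITE normal subgroup `J` in characteristic `0`, `U^J ≅ U_J` equivariantly (projector
   `|J|⁻¹ ∑_j τ(j)`), whence `|J| tr(x ∣ U_J) = ∑_{j ∈ J} tr(τ(x) τ(j))`
   (`card_mul_trace_restrict_invariants`, Serre, *Linear Representations*, §2.6).
3. `prod_reverse_charpoly_toCoinvariants_twist_eq_pow` — the core identity on `Q`: by 2.,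
   `|J| tr((ψ(φ)φ)^m ∣ (C ⊗ ψ)_J) = ∑_j ψ(φ^m j) tr(τ(φ^m j))`; summing over the family,
   `∑ᵢ ψᵢ(φ^m j) = N [φ^m j ∈ Q_F]`; at most one `j` qualifies (`J ∩ Q_F = 1`), one does iff
   `f ∣ m`, and then `φ^m j = Φ^{m/f}` (two elements of `Q_F ∩ φ^m J` coincide).
4. Descent `D → Q` (`finite_map_mk`, `card_map_mk`, `map_mk_inf_map_mk_eq_bot`,
   `mk_mem_map_mk_iff`, `quotientToCoinvariants_mk_eq`) and **coinvariants in stages with a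
   twist**, `charpoly_toCoinvariants_twist_eq_quotient`: `(V ⊗ ψ)_I ≅ (V_{I ∩ D_F} ⊗ ψ̄)_J`
   compatibly with `φ` (third isomorphism theorem).

## References

* E. Artin, *Zur Theorie der L-Reihen mit allgemeinen Gruppencharakteren*, Abh. Math. Sem.
  Hamburg 8 (1931), §2. [ArtinHamburg1931]
* J.-P. Serre, *Facteurs locaux des fonctions zêta des variétés algébriques*, Sém.
  Delange–Pisot–Poitou 1969/70, exp. 19, §2.3 (local factors on `V_I`), §4.1 (no bib key in the tree; cited as in `HasseWeilAbelian`).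
* J. Neukirch, *Algebraic Number Theory* (1999), VII §10, (10.4) (iv) and its proof
  (inductivity of Artin `L`-factors, pp. 522–524). [NeukirchANT1999]
* J.-P. Serre, *Linear Representations of Finite Groups*, GTM 42, §2.6.
  [SerreLinearRepresentations1977]
-/

noncomputable section

open Polynomial PowerSeries Literature.RepresentationTheory.Semisimple
  Literature.RepresentationTheory.FiniteGroups

namespace Literature.NumberTheory.GaloisRepresentations

universe u

/-! ### From traces of powers to Euler polynomials: product = power form -/

section TraceToDet

variable {k : Type*} [Field k] [CharZero k]
  {ι : Type*} [Fintype ι] {W : ι → Type*} [∀ i, AddCommGroup (W i)] [∀ i, Module k (W i)]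
  [∀ i, FiniteDimensional k (W i)]
  {U : Type*} [AddCommGroup U] [Module k U] [FiniteDimensional k U]

/-- `exp` of an `ℕ`-multiple is the power of `exp` (for series without constant term).
[folklore] -/
theorem exp_subst_nsmul (L : PowerSeries k) (hL : constantCoeff L = 0) (g : ℕ) :
    (exp k).subst (g • L) = ((exp k).subst L) ^ g := by
  have h := Literature.AlgebraicGeometry.Motives.FrobeniusTrace.exp_subst_sum
    (Finset.univ : Finset (Fin g)) (fun _ => L) (fun _ _ => hL)
  simpa using h

/-- **Traces of powers determine Euler polynomials — product = power form.**  Let `B i`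
(`i ∈ ι`, finite) and `M` be endomorphisms of finite-dimensional vector spaces over a field of
characteristic zero, `f ≥ 1`, `g ≥ 0`, with
`∑ᵢ tr(Bᵢ^m) = [f ∣ m] · g f · tr(M^{m/f})` for all `m ≥ 1`.  Then
`∏ᵢ det(1 - X Bᵢ) = det(1 - X^f M)^g`.  (Logarithmic form of the Euler factors: both sides are
`exp(-∑_m ∑ᵢ tr(Bᵢ^m) X^m/m)`; Artin 1931, §2.) [folklore] -/
theorem prod_reverse_charpoly_eq_pow_expand_of_trace_pow (B : ∀ i, W i →ₗ[k] W i)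
    (M : U →ₗ[k] U) (f g : ℕ) (hf : f ≠ 0)
    (h : ∀ m : ℕ, 0 < m → ∑ i, LinearMap.trace k (W i) (B i ^ m) =
      if f ∣ m then (g : k) * f * LinearMap.trace k U (M ^ (m / f)) else 0) :
    ∏ i, (B i).charpoly.reverse = (Polynomial.expand k f M.charpoly.reverse) ^ g := by
  -- the trace series
  set LB : ι → PowerSeries k := fun i =>
    PowerSeries.mk fun m => (m : ℚ)⁻¹ • LinearMap.trace k (W i) (B i ^ m) with hLB
  set LM : PowerSeries k := PowerSeries.expand f hf
    (PowerSeries.mk fun m => (m : ℚ)⁻¹ • LinearMap.trace k U (M ^ m)) with hLM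
  have hLB0 : ∀ i ∈ (Finset.univ : Finset ι), constantCoeff (LB i) = 0 := fun i _ => by
    rw [hLB]; exact constantCoeff_endTraceLogSeries (B i)
  have hLM0 : constantCoeff LM = 0 := by
    rw [hLM, PowerSeries.constantCoeff_expand, constantCoeff_endTraceLogSeries]
  -- `∑ᵢ L_{Bᵢ} = g • expand f L_M`
  have hsum : ∑ i, LB i = g • LM := by
    ext m
    simp only [hLB, hLM, map_sum, coeff_mk, map_nsmul, PowerSeries.coeff_expand]
    rcases Nat.eq_zero_or_pos m with rfl | hm
    · simp
    · rw [← Finset.smul_sum, h m hm]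
      split_ifs with hd
      · obtain ⟨q, rfl⟩ := hd
        have hq : q ≠ 0 := by rintro rfl; simp at hm
        rw [Nat.mul_div_cancel_left q (Nat.pos_of_ne_zero hf), nsmul_eq_mul]
        simp only [Algebra.smul_def, map_inv₀, map_natCast, Nat.cast_mul, map_mul]
        have hfk : (f : k) ≠ 0 := Nat.cast_ne_zero.mpr hf
        have hqk : (q : k) ≠ 0 := Nat.cast_ne_zero.mpr hq
        field_simp
      · rw [smul_zero, smul_zero]
  -- `exp(∑ L_{Bᵢ}) ∏ det_i = 1`
  have h1 : (exp k).subst (∑ i, LB i) * ∏ i, ((B i).charpoly.reverse : PowerSeries k) = 1 := by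
    rw [Literature.AlgebraicGeometry.Motives.FrobeniusTrace.exp_subst_sum _ _ hLB0,
      ← Finset.prod_mul_distrib]
    refine Finset.prod_eq_one fun i _ => ?_
    rw [hLB]
    exact Literature.AlgebraicGeometry.Motives.FrobeniusTrace.exp_subst_endTraceLogSeries_mul_reverse_charpoly (R := k) (B i)
  -- `exp(g • L_M) (expand det_M)^g = 1`
  have h2 : (exp k).subst (∑ i, LB i) *
      ((Polynomial.expand k f M.charpoly.reverse : Polynomial k) : PowerSeries k) ^ g = 1 := by
    rw [hsum, exp_subst_nsmul LM hLM0 g, ← mul_pow, hLM,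
      exp_subst_expand_mul_expand_reverse_charpoly M f hf, one_pow]
  -- cancel the common unit
  have h3 : (∏ i, ((B i).charpoly.reverse : PowerSeries k)) =
      ((Polynomial.expand k f M.charpoly.reverse : Polynomial k) : PowerSeries k) ^ g := by
    calc (∏ i, ((B i).charpoly.reverse : PowerSeries k))
        = (∏ i, ((B i).charpoly.reverse : PowerSeries k)) * ((exp k).subst (∑ i, LB i) *
            ((Polynomial.expand k f M.charpoly.reverse : Polynomial k) : PowerSeries k) ^ g) := by
          rw [h2, mul_one]
      _ = ((exp k).subst (∑ i, LB i) * ∏ i, ((B i).charpoly.reverse : PowerSeries k)) *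
            ((Polynomial.expand k f M.charpoly.reverse : Polynomial k) : PowerSeries k) ^ g := by
          ring
      _ = _ := by rw [h1, one_mul]
  have h4 : ((∏ i, (B i).charpoly.reverse : Polynomial k) : PowerSeries k) =
      ∏ i, ((B i).charpoly.reverse : PowerSeries k) :=
    map_prod (Polynomial.coeToPowerSeries.ringHom (R := k)) _ _
  have h5 : (((Polynomial.expand k f M.charpoly.reverse) ^ g : Polynomial k) : PowerSeries k) =
      ((Polynomial.expand k f M.charpoly.reverse : Polynomial k) : PowerSeries k) ^ g :=
    map_pow (Polynomial.coeToPowerSeries.ringHom (R := k)) _ _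
  rw [← h4, ← h5, Polynomial.coe_inj] at h3
  exact h3

end TraceToDet

/-! ### Coinvariants versus invariants of a finite normal subgroup (characteristic zero) -/

section CoinvInv

variable {k : Type*} [Field k] {Γ : Type*} [Group Γ]
  {U : Type*} [AddCommGroup U] [Module k U]
  (τ : Representation k Γ U) (J : Subgroup Γ) [Fintype J]

/-- The averaging operator `∑_{j ∈ J} τ(j)` kills the kernel `⟨τ(j)u - u⟩` of `U → U_J`.
[folklore] -/
theorem sum_apply_eq_zero_of_mem_ker {v : U}
    (hv : v ∈ Representation.Coinvariants.ker (τ.comp J.subtype)) :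
    (∑ j : J, τ j v) = 0 := by
  set P : U →ₗ[k] U := ∑ j : J, τ (j : Γ) with hP
  have hPapply : ∀ u, P u = ∑ j : J, τ j u := fun u => by simp [hP, LinearMap.sum_apply]
  have hPj : ∀ j₀ : J, P ∘ₗ τ (j₀ : Γ) = P := fun j₀ => by
    apply LinearMap.ext
    intro u
    rw [LinearMap.comp_apply, hPapply, hPapply]
    simp_rw [← Module.End.mul_apply, ← map_mul]
    exact Fintype.sum_equiv (Equiv.mulRight j₀) _ _ fun j => by simp
  have hle : Representation.Coinvariants.ker (τ.comp J.subtype) ≤ LinearMap.ker P := by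
    refine Submodule.span_le.2 ?_
    rintro _ ⟨⟨j, u⟩, rfl⟩
    simp only [SetLike.mem_coe, LinearMap.mem_ker, map_sub]
    change P (τ (j : Γ) u) - P u = 0
    rw [← LinearMap.comp_apply, hPj j, sub_self]
  have h := hle hv
  rw [LinearMap.mem_ker, hPapply] at h
  exact h

/-- A `J`-invariant vector in the kernel of `U → U_J` vanishes (`|J| v = ∑_j τ(j) v = 0`,
characteristic zero). [folklore] -/
theorem eq_zero_of_mem_invariants_of_mem_ker [CharZero k] {v : U}
    (hv : v ∈ Representation.invariants (τ.comp J.subtype))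
    (hv' : v ∈ Representation.Coinvariants.ker (τ.comp J.subtype)) : v = 0 := by
  have h1 := sum_apply_eq_card_smul τ J hv
  rw [sum_apply_eq_zero_of_mem_ker τ J hv'] at h1
  have hJ : (Fintype.card J : k) ≠ 0 := Nat.cast_ne_zero.mpr Fintype.card_ne_zero
  exact (smul_eq_zero.mp h1.symm).resolve_left hJ

/-- `u ≡ |J|⁻¹ ∑_j τ(j) u` modulo the kernel of `U → U_J`. [folklore] -/
theorem sub_smul_sum_apply_mem_ker [CharZero k] (u : U) :
    u - (Fintype.card J : k)⁻¹ • (∑ j : J, τ j u) ∈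
      Representation.Coinvariants.ker (τ.comp J.subtype) := by
  have hJ : (Fintype.card J : k) ≠ 0 := Nat.cast_ne_zero.mpr Fintype.card_ne_zero
  have h : u - (Fintype.card J : k)⁻¹ • (∑ j : J, τ j u) =
      (Fintype.card J : k)⁻¹ • ∑ j : J, (u - τ j u) := by
    rw [Finset.sum_sub_distrib, Finset.sum_const, Finset.card_univ, smul_sub, ← Nat.cast_smul_eq_nsmul k,
      smul_smul, inv_mul_cancel₀ hJ, one_smul]
  rw [h]
  refine Submodule.smul_mem _ _ (Submodule.sum_mem _ fun j _ => ?_)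
  have := sub_mem_ker_comp_subtype τ (J := J) j.2 u
  rw [← neg_sub]
  exact Submodule.neg_mem _ this

/-- **`U^J ≅ U_J` commutes with the action of `Γ`: equal characteristic polynomials.**  For a
finite normal subgroup `J` of `Γ` acting on a finite-dimensional `U` in characteristic zero and
any `x ∈ Γ`, the action of `x` on the coinvariants `U_J` and on the invariants `U^J` have the
same characteristic polynomial (the map `U^J → U → U_J` is a `Γ`-isomorphism, with inverse
induced by the projector `|J|⁻¹ ∑_j τ(j)`; Serre, *Linear Representations*, §2.6).
[folklore] -/
theorem charpoly_toCoinvariants_eq_charpoly_restrict_invariants [CharZero k] [J.Normal]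
    [FiniteDimensional k U] (x : Γ)
    (hx : Set.MapsTo (τ x) ↑(Representation.invariants (τ.comp J.subtype))
      ↑(Representation.invariants (τ.comp J.subtype))) :
    (τ.toCoinvariants J x).charpoly = ((τ x).restrict hx).charpoly := by
  set UJ := Representation.invariants (τ.comp J.subtype) with hUJ
  set φ : UJ →ₗ[k] Representation.Coinvariants (τ.comp J.subtype) :=
    (Representation.Coinvariants.mk _) ∘ₗ UJ.subtype with hφ
  have hφapply : ∀ v : UJ, φ v = Representation.Coinvariants.mk _ (v : U) := fun v => rfl
  have hinj : Function.Injective φ := by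
    rw [← LinearMap.ker_eq_bot, Submodule.eq_bot_iff]
    intro v hv
    rw [LinearMap.mem_ker, hφapply, Representation.Coinvariants.mk_eq_zero] at hv
    exact Subtype.ext (eq_zero_of_mem_invariants_of_mem_ker τ J v.2 hv)
  have hsurj : Function.Surjective φ := by
    intro c
    obtain ⟨u, rfl⟩ := Representation.Coinvariants.mk_surjective _ c
    refine ⟨⟨(Fintype.card J : k)⁻¹ • ∑ j : J, τ j u,
      Submodule.smul_mem _ _ (sum_apply_mem_invariants τ J u)⟩, ?_⟩
    rw [hφapply, Representation.Coinvariants.mk_eq_iff]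
    have h := sub_smul_sum_apply_mem_ker τ J u
    rw [← neg_sub] at h ⊢
    exact Submodule.neg_mem _ (by simpa using h)
  set e := LinearEquiv.ofBijective φ ⟨hinj, hsurj⟩ with he
  symm
  refine charpoly_eq_of_semiconj e fun v => ?_
  change φ ((τ x).restrict hx v) = τ.toCoinvariants J x (φ v)
  rw [hφapply, hφapply, Representation.toCoinvariants_mk]
  rfl

/-- **Averaging formula for traces on coinvariants.**  For a finite normal subgroup `J ≤ Γ`
acting on a finite-dimensional `U` in characteristic zero and `x ∈ Γ`:
`|J| · tr(x ∣ U_J) = ∑_{j ∈ J} tr(τ(x) τ(j) ∣ U)`. [folklore] -/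
theorem card_mul_trace_toCoinvariants [CharZero k] [J.Normal] [FiniteDimensional k U] (x : Γ) :
    (Fintype.card J : k) * LinearMap.trace k _ (τ.toCoinvariants J x) =
      ∑ j : J, LinearMap.trace k U (τ x ∘ₗ τ j) := by
  have hx : Set.MapsTo (τ x) ↑(Representation.invariants (τ.comp J.subtype))
      ↑(Representation.invariants (τ.comp J.subtype)) :=
    mapsTo_invariants_of_conj_mem τ J fun j hj => Subgroup.Normal.conj_mem' inferInstance j hj x
  rw [← card_mul_trace_restrict_invariants τ J (τ x) hx,
    LinearMap.trace_eq_of_charpoly_eq _ _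
      (charpoly_toCoinvariants_eq_charpoly_restrict_invariants τ J x hx)]

end CoinvInv

/-! ### The core identity on a quotient in which inertia has become finite -/

section Core

variable {k : Type*} [Field k] [CharZero k] {Q : Type*} [Group Q]
  {C : Type*} [AddCommGroup C] [Module k C] [FiniteDimensional k C]
  (τ : Representation k Q C) {J QF : Subgroup Q} [J.Normal] [Fintype J]

omit [Fintype J] in
/-- Powers of the Frobenius of `w` against powers of the Frobenius downstairs: if
`Φ (φ^f)⁻¹ ∈ J ⊴ Q` then `(φ^{fr})⁻¹ Φ^r ∈ J` for all `r`. [folklore] -/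
theorem pow_inv_mul_pow_mem {φ Φ : Q} {f : ℕ} (hΦ : Φ * (φ ^ f)⁻¹ ∈ J) (r : ℕ) :
    (φ ^ (f * r))⁻¹ * Φ ^ r ∈ J := by
  induction r with
  | zero => simp
  | succ r ih =>
    have h1 : (φ ^ f)⁻¹ * Φ ∈ J := by
      have := Subgroup.Normal.conj_mem inferInstance _ hΦ (φ ^ f)⁻¹
      simpa [mul_assoc] using this
    have h2 : (φ ^ f)⁻¹ * ((φ ^ (f * r))⁻¹ * Φ ^ r) * (φ ^ f) ∈ J := by
      have := Subgroup.Normal.conj_mem inferInstance _ ih (φ ^ f)⁻¹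
      simpa [mul_assoc] using this
    have h3 : (φ ^ (f * (r + 1)))⁻¹ * Φ ^ (r + 1) =
        ((φ ^ f)⁻¹ * ((φ ^ (f * r))⁻¹ * Φ ^ r) * (φ ^ f)) * ((φ ^ f)⁻¹ * Φ) := by
      rw [Nat.mul_succ, pow_add, pow_succ]
      group
    rw [h3]
    exact J.mul_mem h2 h1

/-- **Abelian local Artin formalism, core identity.**  Let `Q` act on the finite-dimensional
`k`-space `C` (`char k = 0`) through `τ`; let `J ⊴ Q` be FINITE (the inertia group made finite)
and `QF ≤ Q` (the absolute Galois group of the top field) with `J ∩ QF = 1`; let `ψ i`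
(`i ∈ ιΨ`, finite) be a family of characters of `Q` satisfying the orthogonality relation
`∑ᵢ ψᵢ(x) = N · [x ∈ QF]` (hypotheses `horth₁`, `horth₀`; so each `ψᵢ` is trivial on `QF`
whenever `N = |ιΨ|`); let `φ ∈ Q` (a Frobenius downstairs), `f ≥ 1` minimal with
`φ^f ∈ J · QF`, `Φ ∈ QF ∩ J φ^f` (a Frobenius upstairs) and `g f |J| = N`.  Then
`∏ᵢ det(1 - X ψᵢ(φ) φ ∣ (C ⊗ ψᵢ)_J) = det(1 - X^f Φ ∣ C)^g`.
Proof by traces (Artin 1931, §2): `|J| tr((ψ(φ)φ)^m ∣ (C ⊗ ψ)_J) = ∑_{j ∈ J} ψ(φ^m j) tr(τ(φ^m j))`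
(averaging), `∑_ψ ψ(φ^m j) = N [φ^m j ∈ QF]`, at most one `j` qualifies, one does iff
`f ∣ m`, and then `φ^m j = Φ^{m/f}` (two elements of `QF ∩ φ^m J` coincide); conclude by
`prod_reverse_charpoly_eq_pow_expand_of_trace_pow`. [folklore] -/
theorem prod_reverse_charpoly_toCoinvariants_twist_eq_pow (hJF : J ⊓ QF = ⊥)
    {ιΨ : Type*} [Fintype ιΨ] (ψ : ιΨ → (Q →* kˣ))
    (N : ℕ) (horth₁ : ∀ x ∈ QF, ∑ i, ((ψ i x : kˣ) : k) = N)
    (horth₀ : ∀ x ∉ QF, ∑ i, ((ψ i x : kˣ) : k) = 0)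
    {φ Φ : Q} {f : ℕ} (hf : 0 < f) (hΦF : Φ ∈ QF) (hΦ : Φ * (φ ^ f)⁻¹ ∈ J)
    (hmin : ∀ m : ℕ, 0 < m → (∃ j ∈ J, φ ^ m * j ∈ QF) → f ∣ m)
    {g : ℕ} (hg : g * f * Fintype.card J = N) :
    ∏ i, ((Representation.twist τ (ψ i)).toCoinvariants J φ).charpoly.reverse =
      (expand k f (τ Φ).charpoly.reverse) ^ g := by
  classical
  have hJ : (Fintype.card J : k) ≠ 0 := Nat.cast_ne_zero.mpr Fintype.card_ne_zero
  -- uniqueness of the `j ∈ J` with `φ^m j ∈ QF`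
  have huniq : ∀ m : ℕ, ∀ j j' : J, φ ^ m * j ∈ QF → φ ^ m * j' ∈ QF → j = j' := by
    intro m j j' hj hj'
    have h1 : ((j : Q)⁻¹ * j' : Q) ∈ QF := by
      have : (φ ^ m * j)⁻¹ * (φ ^ m * j') ∈ QF := QF.mul_mem (QF.inv_mem hj) hj'
      simpa [mul_assoc] using this
    have h2 : ((j : Q)⁻¹ * j' : Q) ∈ J := J.mul_mem (J.inv_mem j.2) j'.2
    have h3 : ((j : Q)⁻¹ * j' : Q) ∈ J ⊓ QF := ⟨h2, h1⟩
    rw [hJF, Subgroup.mem_bot, inv_mul_eq_one] at h3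
    exact Subtype.ext h3
  -- the trace identities
  refine prod_reverse_charpoly_eq_pow_expand_of_trace_pow
    (fun i => (Representation.twist τ (ψ i)).toCoinvariants J φ) (τ Φ) f g hf.ne'
    fun m hm => ?_
  -- `|J| ∑_ψ tr = ∑_j (∑_ψ ψ(φ^m j)) tr(τ(φ^m j)) = ∑_j [φ^m j ∈ QF] N tr(τ(φ^m j))`
  have hkey : (Fintype.card J : k) * ∑ i, LinearMap.trace k _
      (((Representation.twist τ (ψ i)).toCoinvariants J φ) ^ m) =
      ∑ j : J, if φ ^ m * j ∈ QF then (N : k) * LinearMap.trace k C (τ (φ ^ m * j)) else 0 := by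
    rw [Finset.mul_sum]
    have h1 : ∀ i, (Fintype.card J : k) * LinearMap.trace k _
        (((Representation.twist τ (ψ i)).toCoinvariants J φ) ^ m) =
        ∑ j : J, ((ψ i (φ ^ m * j) : kˣ) : k) * LinearMap.trace k C (τ (φ ^ m * j)) := by
      intro i
      rw [← map_pow, card_mul_trace_toCoinvariants]
      refine Finset.sum_congr rfl fun j _ => ?_
      rw [← Module.End.mul_eq_comp, ← map_mul, Representation.twist_apply, map_smul,
        smul_eq_mul]
    simp_rw [h1]
    rw [Finset.sum_comm]
    refine Finset.sum_congr rfl fun j _ => ?_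
    rw [← Finset.sum_mul]
    split_ifs with hjF
    · rw [horth₁ _ hjF]
    · rw [horth₀ _ hjF, zero_mul]
  rw [← mul_right_inj' hJ, hkey]
  by_cases hex : ∃ j ∈ J, φ ^ m * j ∈ QF
  · -- `f ∣ m`, `m = f r`, and the unique `j` gives `φ^m j = Φ^r`
    obtain ⟨r, rfl⟩ := hmin m hm hex
    set j₀ : J := ⟨(φ ^ (f * r))⁻¹ * Φ ^ r, pow_inv_mul_pow_mem hΦ r⟩ with hj₀
    have hj₀F : φ ^ (f * r) * j₀ ∈ QF := by
      rw [hj₀]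
      simpa using QF.pow_mem hΦF r
    rw [Finset.sum_eq_single j₀ (fun j _ hj => if_neg fun hjF => hj (huniq _ j j₀ hjF hj₀F))
      (fun h => (h (Finset.mem_univ _)).elim), if_pos hj₀F, if_pos (Dvd.intro r rfl),
      Nat.mul_div_cancel_left r hf, ← hg]
    have hΦr : φ ^ (f * r) * j₀ = Φ ^ r := by rw [hj₀]; simp
    rw [hΦr, map_pow]
    push_cast
    ring
  · -- no `j` qualifies: both sides vanish
    have hndvd : ¬ f ∣ m := by
      rintro ⟨r, rfl⟩
      exact hex ⟨(φ ^ (f * r))⁻¹ * Φ ^ r, pow_inv_mul_pow_mem hΦ r, by simpa using QF.pow_mem hΦF r⟩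
    rw [if_neg hndvd, mul_zero]
    refine Finset.sum_eq_zero fun j _ => if_neg fun hj => hex ⟨j, j.2, hj⟩

end Core

/-! ### Descent of the data from `D` to `Q = D / (I ∩ D_F)` -/

section Descent

variable {k : Type*} [Field k] {D : Type*} [Group D]
  {V : Type*} [AddCommGroup V] [Module k V]
  (ρ : Representation k D V) (I DF : Subgroup D) [I.Normal] [DF.Normal]

/-- The image `J` of `I` in `Q = D ⧸ (I ∩ D_F)` is finite when `D_F` has finite index in `D`
(it is a quotient of `I ⧸ (I ∩ D_F)`). [folklore] -/
theorem finite_map_mk [DF.FiniteIndex] : Finite (I.map (QuotientGroup.mk' (I ⊓ DF))) := by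
  haveI : (DF.subgroupOf I).FiniteIndex := inferInstance
  haveI : Finite (I ⧸ DF.subgroupOf I) := Subgroup.finite_quotient_of_finiteIndex
  let F : I ⧸ DF.subgroupOf I → I.map (QuotientGroup.mk' (I ⊓ DF)) :=
    Quotient.lift (fun i : I => ⟨QuotientGroup.mk' (I ⊓ DF) (i : D), ⟨i, i.2, rfl⟩⟩)
      (by
        intro a b hab
        apply Subtype.ext
        change ((a : D) : D ⧸ (I ⊓ DF)) = ((b : D) : D ⧸ (I ⊓ DF))
        rw [QuotientGroup.eq]
        have h : (a : D)⁻¹ * b ∈ DF := by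
          have := QuotientGroup.leftRel_apply.mp hab
          exact this
        exact ⟨I.mul_mem (I.inv_mem a.2) b.2, h⟩)
  refine Finite.of_surjective F ?_
  rintro ⟨_, i, hi, rfl⟩
  exact ⟨Quotient.mk _ ⟨i, hi⟩, rfl⟩

/-- `|J| = [I : I ∩ D_F]` for the image `J` of `I` in `Q = D ⧸ (I ∩ D_F)`. [folklore] -/
theorem card_map_mk : Nat.card (I.map (QuotientGroup.mk' (I ⊓ DF))) = (DF.subgroupOf I).index := by
  set F : I →* D ⧸ (I ⊓ DF) := (QuotientGroup.mk' (I ⊓ DF)).comp I.subtype with hF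
  have hker : F.ker = DF.subgroupOf I := by
    ext i
    rw [MonoidHom.mem_ker, hF, MonoidHom.comp_apply, Subgroup.subtype_apply,
      QuotientGroup.mk'_apply, QuotientGroup.eq_one_iff, Subgroup.mem_subgroupOf]
    exact ⟨fun h => h.2, fun h => ⟨i.2, h⟩⟩
  have hrange : F.range = I.map (QuotientGroup.mk' (I ⊓ DF)) := by
    rw [hF, MonoidHom.range_comp, Subgroup.range_subtype]
  rw [← hrange, ← Nat.card_congr (QuotientGroup.quotientKerEquivRange F).toEquiv, hker,
    Subgroup.index]

/-- `J ∩ Q_F = 1` in `Q = D ⧸ (I ∩ D_F)`. [folklore] -/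
theorem map_mk_inf_map_mk_eq_bot :
    I.map (QuotientGroup.mk' (I ⊓ DF)) ⊓ DF.map (QuotientGroup.mk' (I ⊓ DF)) = ⊥ := by
  rw [eq_bot_iff]
  rintro x ⟨⟨i, hi, rfl⟩, ⟨d, hd, hid⟩⟩
  rw [Subgroup.mem_bot, QuotientGroup.mk'_apply, QuotientGroup.eq_one_iff]
  refine ⟨hi, ?_⟩
  rw [QuotientGroup.mk'_apply, QuotientGroup.mk'_apply, QuotientGroup.eq] at hid
  have : d * (d⁻¹ * i) ∈ DF := DF.mul_mem hd hid.2
  simpa using this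

/-- Membership in `Q_F`: `mk x ∈ D_F.map mk ↔ x ∈ D_F` (as `I ∩ D_F ≤ D_F`). [folklore] -/
theorem mk_mem_map_mk_iff (x : D) :
    QuotientGroup.mk' (I ⊓ DF) x ∈ DF.map (QuotientGroup.mk' (I ⊓ DF)) ↔ x ∈ DF := by
  constructor
  · rintro ⟨d, hd, hdx⟩
    rw [QuotientGroup.mk'_apply, QuotientGroup.mk'_apply, QuotientGroup.eq] at hdx
    have : d * (d⁻¹ * x) ∈ DF := DF.mul_mem hd hdx.2
    simpa using this
  · intro hx
    exact ⟨x, hx, rfl⟩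

/-- On `C = V_{I ∩ D_F}`, the class of `Φ` acts as `Φ` (Mathlib `ofQuotient_coe_apply`).
[folklore] -/
theorem quotientToCoinvariants_mk_eq (Φ : D) :
    ρ.quotientToCoinvariants (I ⊓ DF) (QuotientGroup.mk' (I ⊓ DF) Φ) =
      ρ.toCoinvariants (I ⊓ DF) Φ := by
  apply LinearMap.ext
  intro x
  exact Representation.ofQuotient_coe_apply _ _ Φ x

/-- **Coinvariants in stages, with a twist.**  Let `S = I ∩ D_F`, `C = V_S` with its action
`τ` of `Q = D ⧸ S`, `J` the image of `I` in `Q`, and `ψ` a character of `D` trivial on `S`,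
with factorisation `ψ̄` through `Q`.  Then `(V ⊗ ψ)_I ≅ (C ⊗ ψ̄)_J` compatibly with the
actions of `φ ∈ D` and of its class: the two have the same characteristic polynomial
(third isomorphism theorem `V ⧸ K₁ ≅ (V ⧸ K₀) ⧸ (K₁ ⧸ K₀)` for the kernels `K₀ ⊆ K₁` defining
`V_S` and `(V ⊗ ψ)_I`). [folklore] -/
theorem charpoly_toCoinvariants_twist_eq_quotient [FiniteDimensional k V] (ψ : D →* kˣ)
    (hψ : I ⊓ DF ≤ ψ.ker) (φ : D) :
    ((Representation.twist ρ ψ).toCoinvariants I φ).charpoly =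
      ((Representation.twist (ρ.quotientToCoinvariants (I ⊓ DF))
          (QuotientGroup.lift (I ⊓ DF) ψ hψ)).toCoinvariants
        (I.map (QuotientGroup.mk' (I ⊓ DF))) (QuotientGroup.mk' (I ⊓ DF) φ)).charpoly := by
  set S := I ⊓ DF with hS
  set τ := ρ.quotientToCoinvariants S with hτ
  set ψ' : D ⧸ S →* kˣ := QuotientGroup.lift S ψ hψ with hψ'
  set J := I.map (QuotientGroup.mk' S) with hJ
  set K₀ : Submodule k V := Representation.Coinvariants.ker (ρ.comp S.subtype) with hK₀
  set K₁ : Submodule k V := Representation.Coinvariants.ker ((Representation.twist ρ ψ).comp I.subtype)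
    with hK₁
  set K₂ : Submodule k (Representation.Coinvariants (ρ.comp S.subtype)) :=
    Representation.Coinvariants.ker ((Representation.twist τ ψ').comp J.subtype) with hK₂
  have hψS : ∀ x ∈ S, ψ x = 1 := fun x hx => hψ hx
  -- `K₀ ≤ K₁`
  have hK01 : K₀ ≤ K₁ := by
    rw [hK₀, hK₁, ← ker_twist_comp_subtype_eq ρ ψ (J := S) hψS]
    exact ker_comp_subtype_mono _ inf_le_left
  -- the action of `Q` on `C`, concretely
  have hτapply : ∀ (x : D) (v : V), τ (QuotientGroup.mk' S x) (Representation.Coinvariants.mk _ v) =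
      Representation.Coinvariants.mk _ (ρ x v) := fun x v => by
    rw [hτ, QuotientGroup.mk'_apply, Representation.ofQuotient_coe_apply,
      Representation.toCoinvariants_mk]
  have htwapply : ∀ (x : D) (v : V),
      Representation.twist τ ψ' (QuotientGroup.mk' S x) (Representation.Coinvariants.mk _ v) =
        Representation.Coinvariants.mk _ (Representation.twist ρ ψ x v) := fun x v => by
    rw [Representation.twist_apply, LinearMap.smul_apply, hτapply, hψ', QuotientGroup.mk'_apply,
      QuotientGroup.lift_mk, Representation.twist_apply, LinearMap.smul_apply, map_smul]
  -- `K₂ = K₁ / K₀`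
  have hK2 : K₂ = K₁.map K₀.mkQ := by
    apply le_antisymm
    · rw [hK₂]
      refine Submodule.span_le.2 ?_
      rintro _ ⟨⟨⟨_, i, hi, rfl⟩, c⟩, rfl⟩
      obtain ⟨v, rfl⟩ := Representation.Coinvariants.mk_surjective _ c
      simp only [SetLike.mem_coe]
      change Representation.twist τ ψ' (QuotientGroup.mk' S i) (Representation.Coinvariants.mk _ v) -
        Representation.Coinvariants.mk _ v ∈ K₁.map K₀.mkQ
      rw [htwapply]
      have hmem : K₀.mkQ (Representation.twist ρ ψ i v - v) ∈ K₁.map K₀.mkQ :=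
        Submodule.mem_map_of_mem (sub_mem_ker_comp_subtype (Representation.twist ρ ψ) (J := I) hi v)
      rw [map_sub] at hmem
      exact hmem
    · refine Submodule.map_le_iff_le_comap.mpr ?_
      rw [hK₁]
      refine Submodule.span_le.2 ?_
      rintro _ ⟨⟨i, v⟩, rfl⟩
      simp only [SetLike.mem_coe, Submodule.mem_comap, Submodule.mkQ_apply]
      change Submodule.Quotient.mk (Representation.twist ρ ψ (i : D) v - v) ∈ K₂
      have h := sub_mem_ker_comp_subtype (Representation.twist τ ψ') (J := J)
        (j := QuotientGroup.mk' S (i : D)) ⟨i, i.2, rfl⟩ (Representation.Coinvariants.mk _ v)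
      rw [htwapply] at h
      exact h
  -- the equivalence `(V ⧸ K₀) ⧸ K₂ ≃ V ⧸ K₁`
  set e : ((V ⧸ K₀) ⧸ K₂) ≃ₗ[k] (V ⧸ K₁) :=
    (Submodule.quotEquivOfEq K₂ (K₁.map K₀.mkQ) hK2).trans
      (Submodule.quotientQuotientEquivQuotient K₀ K₁ hK01) with he
  have heapply : ∀ v : V, e (Submodule.Quotient.mk (Submodule.Quotient.mk v)) =
      Submodule.Quotient.mk v := fun v => rfl
  symm
  refine charpoly_eq_of_semiconj e fun x => ?_
  induction x using Submodule.Quotient.induction_on with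
  | H c =>
    induction c using Submodule.Quotient.induction_on with
    | H v =>
      change e (Submodule.Quotient.mk (Representation.twist τ ψ' (QuotientGroup.mk' S φ)
          (Representation.Coinvariants.mk _ v))) =
        Representation.Coinvariants.mk _ (Representation.twist ρ ψ φ v)
      rw [htwapply]
      exact heapply _

/-- **Abelian local Artin formalism on inertia coinvariants (all places), `D`-level form.**
Let `ρ` be a representation of a group `D` (a decomposition group) on a finite-dimensional
`k`-space `V` (`char k = 0`), `I ⊴ D` (inertia) and `D_F ⊴ D` of finite index (the
decomposition group of the top field `F`; `D/D_F = Gal(F_w/K_v)` is abelian in the application),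
and `ψᵢ` (`i ∈ ιΨ`, finite) characters of `D`, trivial on `I ∩ D_F`, with the orthogonality
relation `∑ᵢ ψᵢ(x) = N [x ∈ D_F]`.  Let `φ ∈ D` (a Frobenius), `f ≥ 1` with `f ∣ m` whenever
`φ^m ∈ I D_F` (`m ≥ 1`), `Φ ∈ D_F ∩ I φ^f` (a Frobenius of `F`), and `g f [I : I ∩ D_F] = N`.
Then

  `∏ᵢ det(1 - X ψᵢ(φ) φ ∣ (V ⊗ ψᵢ)_I) = det(1 - X^f Φ ∣ V_{I ∩ D_F})^g`,

the representation-theoretic content of `∏_{w ∣ v} L_w(V|_F, X^{f}) = ∏_χ L_v(V ⊗ χ, X)` for an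
abelian extension at an ARBITRARY place `v` (`I` may act non-trivially, non-unipotently).  Proof:
pass to `Q = D ⧸ (I ∩ D_F)`, where inertia becomes the finite group `J = I/(I ∩ D_F)` and
`(V ⊗ ψ)_I = (V_{I ∩ D_F} ⊗ ψ̄)_J` (`charpoly_toCoinvariants_twist_eq_quotient`), and apply
`prod_reverse_charpoly_toCoinvariants_twist_eq_pow` (traces: Artin 1931, §2).
Ref: Serre, *Facteurs locaux des fonctions zêta* (1970), §2.3, §4.1 (local factors on inertia
coinvariants; additivity and inductivity); Neukirch, *Algebraic Number Theory*, VII (10.4) (iv).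
[folklore] -/
theorem prod_reverse_charpoly_toCoinvariants_twist_eq_pow_expand [CharZero k]
    [FiniteDimensional k V] [DF.FiniteIndex]
    {ιΨ : Type*} [Fintype ιΨ] (ψ : ιΨ → (D →* kˣ)) (hψ : ∀ i, I ⊓ DF ≤ (ψ i).ker)
    (N : ℕ) (horth₁ : ∀ x ∈ DF, ∑ i, ((ψ i x : kˣ) : k) = N)
    (horth₀ : ∀ x ∉ DF, ∑ i, ((ψ i x : kˣ) : k) = 0)
    {φ Φ : D} {f : ℕ} (hf : 0 < f) (hΦF : Φ ∈ DF) (hΦ : Φ * (φ ^ f)⁻¹ ∈ I)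
    (hmin : ∀ m : ℕ, 0 < m → (∃ i ∈ I, φ ^ m * i ∈ DF) → f ∣ m)
    {g : ℕ} (hg : g * f * (DF.subgroupOf I).index = N) :
    ∏ i, ((Representation.twist ρ (ψ i)).toCoinvariants I φ).charpoly.reverse =
      (expand k f (ρ.toCoinvariants (I ⊓ DF) Φ).charpoly.reverse) ^ g := by
  set S := I ⊓ DF with hS
  haveI : Finite (I.map (QuotientGroup.mk' S)) := finite_map_mk I DF
  letI : Fintype (I.map (QuotientGroup.mk' S)) := Fintype.ofFinite _
  -- move everything to `Q = D ⧸ S`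
  simp_rw [fun i => charpoly_toCoinvariants_twist_eq_quotient ρ I DF (ψ i) (hψ i) φ]
  rw [← quotientToCoinvariants_mk_eq ρ I DF Φ]
  refine prod_reverse_charpoly_toCoinvariants_twist_eq_pow (ρ.quotientToCoinvariants S)
    (QF := DF.map (QuotientGroup.mk' S)) (map_mk_inf_map_mk_eq_bot I DF)
    (fun i => QuotientGroup.lift S (ψ i) (hψ i)) N ?_ ?_ hf ⟨Φ, hΦF, rfl⟩ ?_ ?_ ?_
  · intro x hx
    obtain ⟨x, rfl⟩ := QuotientGroup.mk_surjective x
    have hx' : x ∈ DF := (mk_mem_map_mk_iff I DF x).mp hx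
    simpa using horth₁ x hx'
  · intro x hx
    obtain ⟨x, rfl⟩ := QuotientGroup.mk_surjective x
    have hx' : x ∉ DF := fun h => hx ((mk_mem_map_mk_iff I DF x).mpr h)
    simpa using horth₀ x hx'
  · rw [← map_pow, ← map_inv, ← map_mul]
    exact ⟨_, hΦ, rfl⟩
  · rintro m hm ⟨_, ⟨i, hi, rfl⟩, hmem⟩
    refine hmin m hm ⟨i, hi, ?_⟩
    rw [← map_pow, ← map_mul] at hmem
    exact (mk_mem_map_mk_iff I DF _).mp hmem
  · rw [← hg, ← card_map_mk I DF, Nat.card_eq_fintype_card]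

end Descent

end Literature.NumberTheory.GaloisRepresentations

end
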